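import Mathlib
import HarnessLib
import Summits.Langlands.Langlands.Theses.QuarterDeficit1951
import Literature.NumberTheory.Automorphic.HyperbolicLaplaceSpectrum
import Literature.NumberTheory.Automorphic.GL2SphericalOfLFactorDegreeTwo
import Literature.NumberTheory.Automorphic.GL2RSLFactorCharacter
import Literature.NumberTheory.Automorphic.TateLocalFactors

/-!
# Ideator sketch — crux `CorrespondentFingerprint` (stmt-Langlands-15898), round 1, ideator 1

First lemmas of the two idea cards (statements only; `sorry` bodies; must elaborate):

* `barrier_eq_zero_of_pos` — card `rational-centre-parity-barrier`: a bounded, `1`-periodic,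
  `C²` solution of `Δu = c·u` on `ℍ` with `c > 0` vanishes (barrier `y^s + y^{1-s}`,
  `s(s-1) = c`, plus the interior maximum principle). Kills the archimedean parameters `{a, -a}`,
  `a ∈ ℤ ∖ {0}` (Casimir/Laplace eigenvalue `1/4 - a² < 0`) once parity has removed the odd
  `K_∞`-types.
* `exists_levelOne_fixed_of_natDegree_rsLFactor` — card `twisted-l-degree-conductor-one`: an
  irreducible smooth generic `π_v` of `GL₂(F)` whose JPSS `L(s, π_v × 1)` AND `L(s, π_v × χ⁻¹)`
  (`χ` of conductor exponent `1`) both have degree `≥ 1` has a non-zero `K₁(𝔭)`-fixed vector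
  (conductor-one analogue of the tree's proved `exists_mem_fixedPoints_glInt_of_hasRSLFactor_natDegree_two`).
-/

open scoped MatrixGroups
open MeasureTheory Polynomial

namespace Summit.Langlands.Langlands.Cruxes.CorrespondentFingerprint.IdeatorSketch1

/-- Card A, first lemma (barrier / no negative spectrum for bounded periodic eigenfunctions):
if `u : ℍ → ℂ` is `C²`, bounded, `1`-periodic and `Δu = c u` with `c > 0` (Iwaniec's
`Δ = y²(∂ₓ² + ∂_y²)`), then `u = 0`. -/
theorem barrier_eq_zero_of_pos (u : UpperHalfPlane → ℂ) (c : ℝ) (hc : 0 < c)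
    (hC2 : Literature.NumberTheory.Automorphic.IsC2 u)
    (heq : ∀ z, Literature.NumberTheory.Automorphic.hypLaplacian u z = (c : ℂ) * u z)
    (hper : ∀ z : UpperHalfPlane, u ((1 : ℝ) +ᵥ z) = u z)
    (hbdd : ∃ C : ℝ, ∀ z, ‖u z‖ ≤ C) :
    ∀ z, u z = 0 := by
  sorry

/-- Card A, corollary shape used by the line: a bounded `1`-periodic `C²` solution of
`Δu + λu = 0` with `λ = 1/4 - a²`, `a` a NON-ZERO integer, vanishes (`c = a² - 1/4 > 0`). -/
theorem eq_zero_of_integral_parameter_ne_zero (u : UpperHalfPlane → ℂ) (a : ℤ) (ha : a ≠ 0)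
    (hC2 : Literature.NumberTheory.Automorphic.IsC2 u)
    (heq : ∀ z, Literature.NumberTheory.Automorphic.hypLaplacian u z +
      (((1 : ℝ) / 4 - (a : ℝ) ^ 2 : ℝ) : ℂ) * u z = 0)
    (hper : ∀ z : UpperHalfPlane, u ((1 : ℝ) +ᵥ z) = u z)
    (hbdd : ∃ C : ℝ, ∀ z, ‖u z‖ ≤ C) :
    ∀ z, u z = 0 := by
  sorry

section Local

open Literature.NumberTheory.Automorphic
open Literature.NumberTheory.GaloisRepresentations.IsNonarchimedeanLocalField

variable {F : Type} [Field F] [ValuativeRel F] [TopologicalSpace F] [IsNonarchimedeanLocalField F]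

/-- Card B, first lemma (conductor-one level vector from two `L`-degrees).  `π_v` irreducible
smooth on `GL₂(F)`, `ψ ≠ 1` continuous, `χ : Fˣ → ℂˣ` trivial on `1 + 𝔭` but not on `𝒪ˣ`
(conductor exponent exactly `1`).  If for every invariant Radon full-support `ν` the JPSS
`L`-polynomials of `π_v × 1` and of `π_v × χ⁻¹` both have degree `≥ 1`, then `π_v` has a non-zero
vector fixed by `K₁(𝔭) = {k ∈ GL₂(𝒪) : k₂₁ ∈ 𝔭, k₂₂ ∈ 1 + 𝔭}`. -/
theorem exists_levelOne_fixed_of_natDegree_rsLFactor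
    (πv : SmoothIrrep (GL (Fin 2) F)) (ψ : AddChar F Circle) (hψ : ψ.IsContinuousNontrivial)
    (χ : Fˣ →* ℂˣ) (hχ1 : ∀ x ∈ unitFiltration F 1, χ x = 1)
    (hχ0 : ∃ x ∈ unitFiltration F 0, χ x ≠ 1)
    (hL1 : ∀ [MeasurableSpace (GL (Fin 1) F ⧸ upperUnitriangular (Fin 1) F)]
      [BorelSpace (GL (Fin 1) F ⧸ upperUnitriangular (Fin 1) F)]
      (ν : Measure (GL (Fin 1) F ⧸ upperUnitriangular (Fin 1) F))
      [SMulInvariantMeasure (GL (Fin 1) F) (GL (Fin 1) F ⧸ upperUnitriangular (Fin 1) F) ν]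
      [IsFiniteMeasureOnCompacts ν] [ν.IsOpenPosMeasure],
      ∃ P : ℂ[X], HasRSLFactor Nat.one_lt_two πv.ρ (Representation.trivial ℂ (GL (Fin 1) F) ℂ)
        ψ ν P ∧ 1 ≤ P.natDegree)
    (hLχ : ∀ [MeasurableSpace (GL (Fin 1) F ⧸ upperUnitriangular (Fin 1) F)]
      [BorelSpace (GL (Fin 1) F ⧸ upperUnitriangular (Fin 1) F)]
      (ν : Measure (GL (Fin 1) F ⧸ upperUnitriangular (Fin 1) F))
      [SMulInvariantMeasure (GL (Fin 1) F) (GL (Fin 1) F ⧸ upperUnitriangular (Fin 1) F) ν]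
      [IsFiniteMeasureOnCompacts ν] [ν.IsOpenPosMeasure],
      ∃ P : ℂ[X], HasRSLFactor Nat.one_lt_two πv.ρ (glOneRep χ⁻¹) ψ ν P ∧ 1 ≤ P.natDegree) :
    ∃ x : πv.V, x ≠ 0 ∧ ∀ k : GL (Fin 2) F, k ∈ glInt 2 F →
      normAbs F ((k : Matrix (Fin 2) (Fin 2) F) 1 0) < 1 →
      normAbs F ((k : Matrix (Fin 2) (Fin 2) F) 1 1 - 1) < 1 → πv.ρ k x = x := by
  sorry

end Local

end Summit.Langlands.Langlands.Cruxes.CorrespondentFingerprint.IdeatorSketch1
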